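/-
Copyright (c) 2026 the pub-hodgecm-mathlib formalisation cell (harness21).  Prover seat hodgecm-mathlib-K2E1-p09 (g3), Track B ∕ K2-LIT,
h413 = `stmt-HodgeConjecture-24833`, line `K2_E1_TraceFormulaBeta`, row 21 (DEAL E ∕ SQ5, part E-b′): the real-quadratic regime at a DYADIC place and
for EVERY prime `p` with `d ≡ 1 (mod 8p)`.  2026-09-04.
-/
import Summits.HodgeConjecture.HodgeConjecture.Theorems.K2E1TransportLetterRealQuadratic   -- ★ p856638 (E-b): `cm_letter_transport_of_isSquare`, `_realQuadratic_of_modEq`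
import Literature.NumberTheory.NumberFields.AdicCompletionSquareCriteria                   -- ★ p856649: `isSquare_adicCompletion_intCast_of_eight_dvd_sub_one`
import HarnessLib

/-!
# h413 ∕ Track B «K2-LIT», line `K2_E1_TraceFormulaBeta`, row 21 (DEAL E ∕ SQ5, part E-b′) — helper `K2E1TransportLetterRealQuadraticAnyPrime`:
# the regime `L' = L(√d)`, `d ≡ 1 (mod 8p)`, at the places above ANY prime `p` (the dyadic case included)

Cell `pub/hodgecm-mathlib`, crux H413 = `stmt-HodgeConjecture-24833`, route `HCCMUnconditional`; chair K2-lead (g0), dealer K2E1-plan (g2).  THEOREMS ONLY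
(no `def`, no `instance`, no `notation`, no named-fact hypothesis, no `sorry`); lane `--kind proof --supports stmt-HodgeConjecture-24833 --as helper`.

★ p856638 `K2E1TransportLetterRealQuadratic.cm_letter_transport_of_isSquare` transports row 21's local letter data along `L ⊆ L' = L(√d)` at every place `𝔭`
of `L⁺` where `d ∈ (L⁺_𝔭)²`, and discharges the square hypothesis for ODD `p ∈ 𝔭` by Hensel.  With the dyadic square criterion ★
`Literature.NumberTheory.NumberFields.isSquare_adicCompletion_intCast_of_eight_dvd_sub_one` («`𝔭 ∣ 2`, `8 ∣ d − 1` ⟹ `d ∈ (L⁺_𝔭)²`», Hensel for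
`X² + X − 2k` in the Henselian ring `𝒪_𝔭`, any ramification over `2`) the regime becomes TOTAL in the currency `d ≡ 1 (mod 8p)` of ★ `K2E1SquarefreeOneModEightP`
∕ ★ `K2E1RealQuadraticSplitAtP` (whose `ℚ_2` clause is exactly the dyadic case):
* `cm_letter_transport_realQuadratic_two` — `𝔭 ∣ 2`, `8 ∣ d − 1`;
* **`cm_letter_transport_realQuadratic_of_modEq_prime`** — ANY prime `p`, `𝔭 ∋ p`, `d ≡ 1 [MOD 8 * p]` (`p = 2`: `16 ∣ d − 1`; `p` odd: ★ `_of_modEq`).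

HONEST LABEL.  Count-neutral helper; proves no printed statement; HC_CM is proved only modulo the 7 printed citations (2 remaining named inputs: hLiu418 =
`stmt-HodgeConjecture-24832`, h413 = `stmt-HodgeConjecture-24833`) until rung 0 closes.

## References
* [Omeara1963] O. T. O'Meara, *Introduction to Quadratic Forms* (1963), §63A (63:1, 63:1a), §65A.
* [Rogawski1990] J. Rogawski, *Automorphic representations of unitary groups in three variables* (1990), §14.2 p. 232 (context: the regime device `L ↦ L·K`).
-/

set_option autoImplicit false
set_option linter.dupNamespace false  -- the mandated namespace repeats the summit's segment (`HodgeConjecture.HodgeConjecture`)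

noncomputable section

namespace Summit.HodgeConjecture.HodgeConjecture.Cruxes.H413.K2E1TransportLetterRealQuadraticAnyPrime

open NumberField IsDedekindDomain
open Literature.NumberTheory.Automorphic Literature.NumberTheory.Automorphic.UnitaryGroup
open Summit.HodgeConjecture.HodgeConjecture.Cruxes.H413.K2E1TransportLetterRealQuadratic

variable (L L' : Type) [Field L] [NumberField L] [IsCMField L] [Field L'] [NumberField L'] [IsCMField L'] [Algebra L L']
  [Algebra.IsQuadraticExtension L L']
  [Algebra ↥(maximalRealSubfield L) ↥(maximalRealSubfield L')] [IsScalarTower ↥(maximalRealSubfield L) ↥(maximalRealSubfield L') L']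
  (N : ℕ) (H : Matrix (Fin N) (Fin N) L)
  (𝔭 : HeightOneSpectrum (𝓞 ↥(maximalRealSubfield L)))
  (𝔓 : HeightOneSpectrum (𝓞 ↥(maximalRealSubfield L'))) (h𝔓 : 𝔓.under (𝓞 ↥(maximalRealSubfield L)) = 𝔭)

include h𝔓 in
/-- **ROW 21's TRANSPORT FOR `L' = L(√d)` AT A DYADIC PLACE**: `𝔭 ∣ 2`, `8 ∣ d − 1`, `𝔓 ∣ 𝔭` (`d ∈ (L⁺_𝔭)²` by the dyadic Hensel criterion
★ `isSquare_adicCompletion_intCast_of_eight_dvd_sub_one`; then ★ `cm_letter_transport_of_isSquare`). [cite: Omeara1963, §63A (63:1), §65A]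
[cite: Rogawski1990, §14.2 p. 232] -/
theorem cm_letter_transport_realQuadratic_two (h𝔭2 : ((2 : ℕ) : 𝓞 ↥(maximalRealSubfield L)) ∈ 𝔭.asIdeal) {d : ℤ} (hd8 : (8 : ℤ) ∣ d - 1)
    (θ : ↥(maximalRealSubfield L')) (hθ : ((θ : L') : L') ^ 2 = (d : L')) (hθL : ∀ r : L, algebraMap L L' r ≠ (θ : L')) :
    ∃ (β : PlacesOver L' 𝔓 ≃ PlacesOver L 𝔭) (e : (cmDatum L N H).Local 𝔭 ≃ₜ* (cmDatum L' N (H.map (algebraMap L L'))).Local 𝔓),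
      (∀ w' : PlacesOver L' 𝔓, (w'.1).under (𝓞 L) = (β w').1) ∧
      Function.Bijective (IrrClass.comap e) ∧
      (∀ κ : IrrClass ((cmDatum L' N (H.map (algebraMap L L'))).Local 𝔓), (IrrClass.comap e κ).IsAdmissible ↔ κ.IsAdmissible) ∧
      (∀ κ : IrrClass ((cmDatum L' N (H.map (algebraMap L L'))).Local 𝔓),
        (IrrClass.comap e κ).IsSpherical (cmLocalIntegralLevel L N H 𝔭) ↔
          κ.IsSpherical (cmLocalIntegralLevel L' N (H.map (algebraMap L L')) 𝔓)) :=
  cm_letter_transport_of_isSquare L L' d θ hθ hθL 𝔭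
    (Literature.NumberTheory.NumberFields.isSquare_adicCompletion_intCast_of_eight_dvd_sub_one 𝔭 h𝔭2 hd8) N H 𝔓 h𝔓

include h𝔓 in
/-- **ROW 21's TRANSPORT FOR `L' = L(√d)`, `d ≡ 1 (mod 8p)`, AT THE PLACES ABOVE ANY PRIME `p`** (`p = 2`: `16 ∣ d − 1` and the dyadic case;
`p` odd: ★ `cm_letter_transport_realQuadratic_of_modEq`). [cite: Omeara1963, §63A (63:1, 63:1a), §65A] [cite: Rogawski1990, §14.2 p. 232] -/
theorem cm_letter_transport_realQuadratic_of_modEq_prime {p : ℕ} (hp : p.Prime) (h𝔭p : (p : 𝓞 ↥(maximalRealSubfield L)) ∈ 𝔭.asIdeal)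
    {d : ℕ} (hmod : d ≡ 1 [MOD 8 * p])
    (θ : ↥(maximalRealSubfield L')) (hθ : ((θ : L') : L') ^ 2 = (d : L')) (hθL : ∀ r : L, algebraMap L L' r ≠ (θ : L')) :
    ∃ (β : PlacesOver L' 𝔓 ≃ PlacesOver L 𝔭) (e : (cmDatum L N H).Local 𝔭 ≃ₜ* (cmDatum L' N (H.map (algebraMap L L'))).Local 𝔓),
      (∀ w' : PlacesOver L' 𝔓, (w'.1).under (𝓞 L) = (β w').1) ∧
      Function.Bijective (IrrClass.comap e) ∧
      (∀ κ : IrrClass ((cmDatum L' N (H.map (algebraMap L L'))).Local 𝔓), (IrrClass.comap e κ).IsAdmissible ↔ κ.IsAdmissible) ∧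
      (∀ κ : IrrClass ((cmDatum L' N (H.map (algebraMap L L'))).Local 𝔓),
        (IrrClass.comap e κ).IsSpherical (cmLocalIntegralLevel L N H 𝔭) ↔
          κ.IsSpherical (cmLocalIntegralLevel L' N (H.map (algebraMap L L')) 𝔓)) := by
  by_cases hp2 : p = 2
  · subst hp2
    -- `16 ∣ d - 1`, so `8 ∣ d - 1`
    have h16 : ((8 * 2 : ℕ) : ℤ) ∣ (d : ℤ) - (1 : ℕ) := Nat.modEq_iff_dvd.1 hmod.symm
    have h8 : (8 : ℤ) ∣ ((8 * 2 : ℕ) : ℤ) := ⟨2, by norm_num⟩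
    have hd8 : (8 : ℤ) ∣ (d : ℤ) - 1 := h8.trans (by exact_mod_cast h16)
    have hθ' : ((θ : L') : L') ^ 2 = ((d : ℤ) : L') := by rw [hθ]; norm_cast
    exact cm_letter_transport_realQuadratic_two L L' N H 𝔭 𝔓 h𝔓 h𝔭p hd8 θ hθ' hθL
  · exact cm_letter_transport_realQuadratic_of_modEq L L' N H hp hp2 𝔭 h𝔭p 𝔓 h𝔓 hmod θ hθ hθL

end Summit.HodgeConjecture.HodgeConjecture.Cruxes.H413.K2E1TransportLetterRealQuadraticAnyPrime

end
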